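/- Width seat `ym-line-sfw-p2-w5` (prover-ym-line-sfw-p2-w5-g18-0), free hands on planner ym-idea-2 g16's LINE-19 task board (STUB-PLAN-S4b §10,
toward the FREE item T5 = the S4b assembly; crux `AllWindowsColdBox.BoxHighWindowsSU22` = stmt-QuantumFields-24004 / 24335, stub S4b):
lattice Landau gauge ⇒ the su(2)-coordinate one-forms are divergence-free at the interior sites (the hypothesis of T2 `hodgeRepresentation′`). -/
import Summits.QuantumFields.YangMills.Theorems.AllWindowsColdBoxBoxHighLineQuaternionBCH

/-!
# LINE-19 S4b §10, first brick of the assembly T5: `InLandauGauge ⇒ g_x · imVec(W)_c = 0` at every interior site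

The bootstrap (STUB-PLAN-S4b §10 T5) applies the Hodge representation ✓`hodgeRepresentation′` to the three su(2)-coordinate one-forms
`a^c_e = imVec (W e)_c` of a configuration `W` in lattice Landau gauge.  Its hypothesis is the divergence condition `g_x · a^c = 0` at the
interior sites; this file derives it from the matrix identity `InLandauGauge` of the line defs:

* `outEdge`, `inEdge` : the free edges `(x, μ)` and `(x − e_μ, μ)` at an interior site `x` (all eight are cold-box edges);
* `sum_ite_base_eq`, `sum_ite_tip_eq` : the sums over free edges with base point `x` / with tip `x` are the sums over the four directions;
* `gradVec_dotProduct_eq_interior` : `g_x · a = Σ_μ a(inEdge x μ) − Σ_μ a(outEdge x μ)`;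
* `imVecM_sum` : additivity of the su(2)-coordinate functional over finite sums;
* **`gradVec_dotProduct_imVec_eq_zero_of_inLandauGauge`** : for `W` in lattice Landau gauge and `x` interior,
  `g_x · (fun e => imVec (W e) c) = 0` for each `c` (apply `imVecM` to the matrix identity; `imVecM (W − Wᴴ) = imVec W + imVec W`).

Everything proved; two bookkeeping definitions (`outEdge`, `inEdge`); standard axioms.  HONEST LABEL: a helper toward ONE registered stub (S4b) of a
critic-PASSed line on the R2ξ″ RECORD-rung crux 24004 / 24335; no stub is proved by name, no crux, rung or summit is proved; the Yang–Mills mass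
gap is NOT proved by this file.
-/

set_option autoImplicit false

noncomputable section

open Finset Matrix
open Literature.MathematicalPhysics.QuantumFieldTheory
open Literature.MathematicalPhysics.QuantumFieldTheory.LatticeMaxwell
open Literature.MathematicalPhysics.QuantumFieldTheory.AxialGauge
open Summit.QuantumFields.YangMills.Theorems.WeakCouplingRates
open Summit.QuantumFields.YangMills.Theorems.AllWindowsColdBox
open Literature.Probability.LatticeModels (Site)
open Literature.MathematicalPhysics.QuantumLattice (LGConfig)

namespace Summit.QuantumFields.YangMills.Theorems.AllWindowsColdBoxBoxHighLine

/-! ## The eight free edges at an interior site -/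

/-- Coordinates of an interior site. -/
theorem interior_bounds {H : ℕ} {x : Site 4} (hx : x ∈ interiorSites H) (k : Fin 4) : 1 ≤ x k ∧ x k + 1 ≤ 2 * (H : ℤ) :=
  (interiorSites_iff H x).1 hx k

/-- The edge `(x, μ)` out of an interior site is a free (cold-box) edge. -/
theorem outEdge_mem {H : ℕ} {x : Site 4} (hx : x ∈ interiorSites H) (μ : Fin 4) :
    (x, μ) ∈ boxEdgesAt dirCorner (2 * H + 3) ∧ ¬ landauPin H (x, μ) := by
  have hb := interior_bounds hx
  constructor
  · rw [LatticeMaxwell.mem_boxEdgesAt, mem_boxEdges_iff]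
    simp only [Pi.sub_apply, dirCorner]
    refine ⟨fun k => ?_, ?_⟩
    · have := hb k; push_cast; constructor <;> omega
    · have := hb μ; push_cast; omega
  · unfold landauPin
    push Not
    rw [mem_boxEdges_iff]
    refine ⟨fun k => ?_, ?_⟩
    · have := hb k; push_cast; constructor <;> omega
    · have := hb μ; push_cast; omega

/-- The edge `(x − e_μ, μ)` into an interior site is a free (cold-box) edge. -/
theorem inEdge_mem {H : ℕ} {x : Site 4} (hx : x ∈ interiorSites H) (μ : Fin 4) :
    (x - Pi.single μ 1, μ) ∈ boxEdgesAt dirCorner (2 * H + 3) ∧ ¬ landauPin H (x - Pi.single μ 1, μ) := by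
  have hb := interior_bounds hx
  constructor
  · rw [LatticeMaxwell.mem_boxEdgesAt, mem_boxEdges_iff]
    simp only [Pi.sub_apply, dirCorner, Pi.single_apply]
    refine ⟨fun k => ?_, ?_⟩
    · have := hb k; split_ifs <;> push_cast <;> omega
    · have := hb μ; simp only [if_true]; push_cast; omega
  · unfold landauPin
    push Not
    rw [mem_boxEdges_iff]
    simp only [Pi.sub_apply, Pi.single_apply]
    refine ⟨fun k => ?_, ?_⟩
    · have := hb k; split_ifs <;> push_cast <;> omega
    · have := hb μ; simp only [if_true]; push_cast; omega

/-- The free edge `(x, μ)` at an interior site `x`. -/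
def outEdge {H : ℕ} {x : Site 4} (hx : x ∈ interiorSites H) (μ : Fin 4) : LandauFree H :=
  ⟨⟨(x, μ), (outEdge_mem hx μ).1⟩, (outEdge_mem hx μ).2⟩

/-- The free edge `(x − e_μ, μ)` at an interior site `x`. -/
def inEdge {H : ℕ} {x : Site 4} (hx : x ∈ interiorSites H) (μ : Fin 4) : LandauFree H :=
  ⟨⟨(x - Pi.single μ 1, μ), (inEdge_mem hx μ).1⟩, (inEdge_mem hx μ).2⟩

/-- The sum over the free edges with base point `x` is the sum over the four out-edges. -/
theorem sum_ite_base_eq {H : ℕ} {x : Site 4} (hx : x ∈ interiorSites H) (a : LandauFree H → ℝ) :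
    ∑ i : LandauFree H, (if i.1.1.1 = x then a i else 0) = ∑ μ : Fin 4, a (outEdge hx μ) := by
  classical
  rw [← Finset.sum_filter]
  have hset : (Finset.univ : Finset (LandauFree H)).filter (fun i => i.1.1.1 = x) =
      (Finset.univ : Finset (Fin 4)).image (fun μ => outEdge hx μ) := by
    ext i
    simp only [Finset.mem_filter, Finset.mem_univ, true_and, Finset.mem_image]
    constructor
    · intro hi
      refine ⟨i.1.1.2, ?_⟩
      apply Subtype.ext; apply Subtype.ext
      show (x, i.1.1.2) = i.1.1
      rw [← hi]
    · rintro ⟨μ, rfl⟩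
      rfl
  rw [hset, Finset.sum_image]
  intro μ _ ν _ h
  have := congrArg (fun i : LandauFree H => i.1.1.2) h
  exact this

/-- The sum over the free edges with tip `x` is the sum over the four in-edges. -/
theorem sum_ite_tip_eq {H : ℕ} {x : Site 4} (hx : x ∈ interiorSites H) (a : LandauFree H → ℝ) :
    ∑ i : LandauFree H, (if i.1.1.1 + Pi.single i.1.1.2 1 = x then a i else 0) = ∑ μ : Fin 4, a (inEdge hx μ) := by
  classical
  rw [← Finset.sum_filter]
  have hset : (Finset.univ : Finset (LandauFree H)).filter (fun i => i.1.1.1 + Pi.single i.1.1.2 1 = x) =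
      (Finset.univ : Finset (Fin 4)).image (fun μ => inEdge hx μ) := by
    ext i
    simp only [Finset.mem_filter, Finset.mem_univ, true_and, Finset.mem_image]
    constructor
    · intro hi
      refine ⟨i.1.1.2, ?_⟩
      apply Subtype.ext; apply Subtype.ext
      show (x - Pi.single i.1.1.2 1, i.1.1.2) = i.1.1
      have hb : x - Pi.single i.1.1.2 1 = i.1.1.1 := by rw [← hi]; simp
      rw [hb]
    · rintro ⟨μ, rfl⟩
      show (x - Pi.single μ 1) + Pi.single μ 1 = x
      simp
  rw [hset, Finset.sum_image]
  intro μ _ ν _ h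
  have := congrArg (fun i : LandauFree H => i.1.1.2) h
  exact this

/-- **The divergence at an interior site**: `g_x · a = Σ_μ a(x − e_μ, μ) − Σ_μ a(x, μ)`. -/
theorem gradVec_dotProduct_eq_interior {H : ℕ} {x : Site 4} (hx : x ∈ interiorSites H) (a : LandauFree H → ℝ) :
    gradVec H x ⬝ᵥ a = (∑ μ : Fin 4, a (inEdge hx μ)) - ∑ μ : Fin 4, a (outEdge hx μ) := by
  rw [← sum_ite_base_eq hx a, ← sum_ite_tip_eq hx a, ← Finset.sum_sub_distrib]
  simp only [dotProduct, gradVec]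
  refine Finset.sum_congr rfl fun i _ => ?_
  split_ifs <;> ring

/-! ## Landau gauge ⇒ divergence-free su(2)-coordinates -/

/-- Additivity of `imVecM` over finite sums. -/
theorem imVecM_sum {ι : Type*} (s : Finset ι) (F : ι → Matrix (Fin 2) (Fin 2) ℂ) :
    imVecM (∑ k ∈ s, F k) = ∑ k ∈ s, imVecM (F k) := by
  classical
  induction s using Finset.induction_on with
  | empty => simp [imVecM]
  | insert a s ha ih => rw [Finset.sum_insert ha, Finset.sum_insert ha, imVecM_add, ih]

/-- `imVecM (W − Wᴴ) = imVec W + imVec W` for `W ∈ SU(2)`. -/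
theorem imVecM_sub_conjTranspose (W : SU2) :
    imVecM ((W : Matrix (Fin 2) (Fin 2) ℂ) - (W : Matrix (Fin 2) (Fin 2) ℂ)ᴴ) = imVec W + imVec W := by
  rw [imVecM_sub, ← Matrix.star_eq_conjTranspose, imVecM_star_coe, ← imVec_eq_imVecM, sub_neg_eq_add]

/-- **Lattice Landau gauge ⇒ the su(2)-coordinate one-forms are divergence-free at the interior sites.** -/
theorem gradVec_dotProduct_imVec_eq_zero_of_inLandauGauge {H : ℕ} {W : LGConfig 4 SU2} (hW : InLandauGauge H W)
    {x : Site 4} (hx : x ∈ interiorSites H) (c : Fin 3) :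
    gradVec H x ⬝ᵥ (fun i : LandauFree H => imVec (W i.1.1) c) = 0 := by
  have h := hW x hx
  have h' := congrArg imVecM h
  rw [imVecM_sum, imVecM_sum] at h'
  simp only [imVecM_sub_conjTranspose, Finset.sum_add_distrib] at h'
  have hc := congrFun h' c
  simp only [Pi.add_apply, Finset.sum_apply] at hc
  rw [gradVec_dotProduct_eq_interior hx]
  show (∑ μ : Fin 4, imVec (W (x - Pi.single μ 1, μ)) c) - ∑ μ : Fin 4, imVec (W (x, μ)) c = 0
  linarith

end Summit.QuantumFields.YangMills.Theorems.AllWindowsColdBoxBoxHighLine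

end
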